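import Summits.FinalStateConjecture.FinalStateConjecture.Theorems.KerrnessPropagatesKillingSpinorEndgameLatenessIdle

/-!
# The interior-lemma hypothesis of `KillingSpinorEndgame` is idle; the good regularities are upward closed
# (crux stmt-FinalStateConjecture-17645, route `KerrnessPropagates`; findings about the LOGICAL SHAPE of the crux)

The crux `Theses.KerrnessPropagates.KillingSpinorEndgame` has the shape

  `∃ k, ∀ 𝒟 …, (i)ₖ 𝒟 → (ii) 𝒟 → ∃ O d, Sub d ∧ O = ext d ∧ Rays O ∧ Exh d ∧ FO d`,

where (i)ₖ is the recurrence clause at regularity `k` (`∀ ε > 0, ∀ τ₁, ∃ τ ≥ τ₁, ∃ R U Φ, SlabClauses 𝒟 k …`,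
p152635's `SlabClauses`, `killingSpinorEndgame_iff : … := Iff.rfl`) and (ii) is the INTERIOR LEMMA handed over by
CAPTURE: `∀ O d, Sub d → O = ext d → Exh d → FO d → Rays O`.

* **F6 — hypothesis (ii) is logically idle** (`endgame_pointwise_iff_honest`, `killingSpinorEndgame_iff_honest`):
  for every development, `((i) → (ii) → ∃ O d, Sub ∧ O = ext ∧ Rays ∧ Exh ∧ FO) ↔ ((i) → ∃ O d, Sub ∧ O = ext ∧ Exh ∧ FO)`.
  Indeed if an honest `(O, d)` exists, (ii) decorates it with `Rays`; if none exists, (ii) holds vacuously and the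
  crux's conclusion produces one. So the crux is EXACTLY "recurrence ⇒ an honest exterior decomposition exists"
  (sub-extremal holes, `O = exteriorOf`, `HasExhaustiveCharts`, `IsFutureOriented`); the interior lemma neither
  helps nor burdens it, and a restatement may drop hypothesis (ii) together with the `RaysStayInClosure` conjunct,
  leaving the application of CAPTURE's interior lemma to the deciding theorem `closes`.
* **Antitonicity / upward closure in `k`** (`SlabClauses.anti`, `recurrence_anti`, `killingSpinorEndgame_at_mono`):
  the slab clauses at regularity `k'` imply those at every `k ≤ k'` (`supCkENorm_mono_right`), so the recurrence
  hypothesis is antitone in `k` and the set of regularities at which the crux's implication holds is upward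
  closed: the leading `∃ k` reads "for all sufficiently large `k`" (the analogue, for the current crux text, of
  `singleKerrEndgame_at_mono` of Theorems/KerrnessPropagatesSingleKerrEndgame.lean, written for the pre-T2 text).

Pure logic over the route file; nothing here touches the open-problem content (sub-extremal Kerr asymptotic
stability in a lab gauge). References: Theses/KerrnessPropagates.lean (stmt-17645); DHRT arXiv:2104.08222, §1.
-/

open Literature.Geometry.Lorentzian
open scoped Manifold ContDiff Topology ENNReal
open Filter Set TopologicalSpace Function

-- `FinalStateConjecture.FinalStateConjecture` repeats summit = sub-problem (D-0017); deliberate.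
set_option linter.dupNamespace false

noncomputable section

namespace Summit.FinalStateConjecture.FinalStateConjecture.Theorems.KerrnessPropagates

open Summit.FinalStateConjecture.FinalStateConjecture.Theses.KerrnessPropagates

variable {X : Type} [TopologicalSpace X] [ChartedSpace E3 X] [IsManifold (𝓡 3) ∞ X]
  [ConnectedSpace X] {D : InitialDataSet (𝓡 3) X}

/-- **F6, pointwise: the interior-lemma hypothesis is idle.** For one development `𝒟` and any
recurrence premise `P`, "`P` and the interior lemma (ii) give an honest decomposition with
`RaysStayInClosure`" is equivalent to "`P` gives an honest decomposition" (sub-extremal holes,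
`O = exteriorOf`, `HasExhaustiveCharts`, `IsFutureOriented`): if an honest `(O, d)` exists, (ii) supplies
`Rays` for it; if none exists, (ii) holds vacuously. Classical propositional logic. [folklore] -/
theorem endgame_pointwise_iff_honest (𝒟 : VacuumCauchyDevelopment D) (P : Prop) :
    (P → (∀ (O : Set 𝒟.carrier) (d : FinalStateDecomposition 𝒟.toSpacetime O 2),
        (∀ i, Kerr.IsSubextremal (d.mass i) (d.spin i)) →
        O = Summit.FinalStateConjecture.exteriorOf 𝒟.toCauchyDevelopment d.charted →
        Summit.FinalStateConjecture.HasExhaustiveCharts d →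
        Summit.FinalStateConjecture.IsFutureOriented d →
        Summit.FinalStateConjecture.RaysStayInClosure 𝒟.toCauchyDevelopment O) →
      ∃ (O : Set 𝒟.carrier) (d : FinalStateDecomposition 𝒟.toSpacetime O 2),
        (∀ i, Kerr.IsSubextremal (d.mass i) (d.spin i)) ∧
        O = Summit.FinalStateConjecture.exteriorOf 𝒟.toCauchyDevelopment d.charted ∧
        Summit.FinalStateConjecture.RaysStayInClosure 𝒟.toCauchyDevelopment O ∧
        Summit.FinalStateConjecture.HasExhaustiveCharts d ∧
        Summit.FinalStateConjecture.IsFutureOriented d) ↔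
    (P → ∃ (O : Set 𝒟.carrier) (d : FinalStateDecomposition 𝒟.toSpacetime O 2),
        (∀ i, Kerr.IsSubextremal (d.mass i) (d.spin i)) ∧
        O = Summit.FinalStateConjecture.exteriorOf 𝒟.toCauchyDevelopment d.charted ∧
        Summit.FinalStateConjecture.HasExhaustiveCharts d ∧
        Summit.FinalStateConjecture.IsFutureOriented d) := by
  constructor
  · intro h hP
    by_cases hex : ∃ (O : Set 𝒟.carrier) (d : FinalStateDecomposition 𝒟.toSpacetime O 2),
        (∀ i, Kerr.IsSubextremal (d.mass i) (d.spin i)) ∧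
        O = Summit.FinalStateConjecture.exteriorOf 𝒟.toCauchyDevelopment d.charted ∧
        Summit.FinalStateConjecture.HasExhaustiveCharts d ∧
        Summit.FinalStateConjecture.IsFutureOriented d
    · exact hex
    · obtain ⟨O, d, hsub, hO, -, hexh, hfo⟩ :=
        h hP fun O d hsub hO hexh hfo ↦ (hex ⟨O, d, hsub, hO, hexh, hfo⟩).elim
      exact ⟨O, d, hsub, hO, hexh, hfo⟩
  · intro h hP hint
    obtain ⟨O, d, hsub, hO, hexh, hfo⟩ := h hP
    exact ⟨O, d, hsub, hO, hint O d hsub hO hexh hfo, hexh, hfo⟩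

/-- **F6: `KillingSpinorEndgame` is equivalent to "recurrence ⇒ an honest exterior decomposition
exists"** — the crux with its interior-lemma hypothesis (ii) AND the `RaysStayInClosure` conjunct of its
conclusion both deleted (clause (i) written with p152635's `SlabClauses`, verbatim the filed block). The
interior lemma handed over by CAPTURE is thus logically idle inside ENDGAME: the crux's entire content
is the EXTERIOR construction. [folklore] -/
theorem killingSpinorEndgame_iff_honest :
    KillingSpinorEndgame ↔
    ∃ k : ℕ, ∀ (X : Type) [TopologicalSpace X] [ChartedSpace E3 X] [IsManifold (𝓡 3) ∞ X]
      [T2Space X] [SecondCountableTopology X] [ConnectedSpace X] (D : InitialDataSet (𝓡 3) X),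
      D ∈ admissibleVacuumData X → ∀ 𝒟 : VacuumCauchyDevelopment D, 𝒟.IsMaximal →
      Summit.FinalStateConjecture.HasCompleteNullInfinity 𝒟.toCauchyDevelopment →
      (∃ (N : ℕ) (M a r₀ : Fin N → ℝ) (mo : Fin N → ↥lorentzGroup × E4),
        (∀ i, Kerr.IsSubextremal (M i) (a i) ∧
          r₀ i ∈ Ioo (Kerr.rMinus (M i) (a i)) (Kerr.rPlus (M i) (a i))) ∧
        ∀ ε : ℝ, 0 < ε → ∀ τ₁ : ℝ, ∃ τ : ℝ, τ₁ ≤ τ ∧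
          ∃ (R : Fin N → ℝ) (U : Opens E4) (Φ : U → 𝒟.carrier),
            SlabClauses 𝒟 k N M a r₀ mo ε τ R U Φ) →
      ∃ (O : Set 𝒟.carrier) (d : FinalStateDecomposition 𝒟.toSpacetime O 2),
        (∀ i, Kerr.IsSubextremal (d.mass i) (d.spin i)) ∧
        O = Summit.FinalStateConjecture.exteriorOf 𝒟.toCauchyDevelopment d.charted ∧
        Summit.FinalStateConjecture.HasExhaustiveCharts d ∧
        Summit.FinalStateConjecture.IsFutureOriented d := by
  rw [killingSpinorEndgame_iff]
  constructor
  · rintro ⟨k, hk⟩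
    refine ⟨k, fun X _ _ _ _ _ _ D hD 𝒟 hmax hscri ↦ ?_⟩
    exact (endgame_pointwise_iff_honest 𝒟 _).1 (hk X D hD 𝒟 hmax hscri)
  · rintro ⟨k, hk⟩
    refine ⟨k, fun X _ _ _ _ _ _ D hD 𝒟 hmax hscri ↦ ?_⟩
    exact (endgame_pointwise_iff_honest 𝒟 _).2 (hk X D hD 𝒟 hmax hscri)

/-- **The slab clauses are antitone in the regularity**: at `k'` they imply those at every `k ≤ k'`
(the two `Cᵏ` sup norms are monotone in `k`, `supCkENorm_mono_right`; the other seven clauses do not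
mention `k`). DHRT arXiv:2104.08222, §1 (convergence with loss of derivatives). [cite: arXiv210408222, §1] -/
theorem SlabClauses.anti {𝒟 : VacuumCauchyDevelopment D} {k k' N : ℕ} (hk : k ≤ k')
    {M a r₀ : Fin N → ℝ} {mo : Fin N → ↥lorentzGroup × E4} {ε τ : ℝ} {R : Fin N → ℝ} {U : Opens E4}
    {Φ : U → 𝒟.carrier} (h : SlabClauses 𝒟 k' N M a r₀ mo ε τ R U Φ) :
    SlabClauses 𝒟 k N M a r₀ mo ε τ R U Φ := by
  obtain ⟨hR, hsm, hemb, hU, hJ, hachr, hnear, hfar, hfd⟩ := h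
  exact ⟨hR, hsm, hemb, hU, hJ, hachr, fun i ↦ (supCkENorm_mono_right _ hk _).trans (hnear i),
    (supCkENorm_mono_right _ hk _).trans hfar, hfd⟩

/-- **The recurrence hypothesis (clause (i)) is antitone in the regularity**: recurrence at `k'` to a
configuration implies recurrence at every `k ≤ k'` to the same configuration. [cite: arXiv210408222, §1] -/
theorem recurrence_anti (𝒟 : VacuumCauchyDevelopment D) {k k' : ℕ} (hk : k ≤ k')
    (h : ∃ (N : ℕ) (M a r₀ : Fin N → ℝ) (mo : Fin N → ↥lorentzGroup × E4),
      (∀ i, Kerr.IsSubextremal (M i) (a i) ∧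
        r₀ i ∈ Ioo (Kerr.rMinus (M i) (a i)) (Kerr.rPlus (M i) (a i))) ∧
      ∀ ε : ℝ, 0 < ε → ∀ τ₁ : ℝ, ∃ τ : ℝ, τ₁ ≤ τ ∧
        ∃ (R : Fin N → ℝ) (U : Opens E4) (Φ : U → 𝒟.carrier),
          SlabClauses 𝒟 k' N M a r₀ mo ε τ R U Φ) :
    ∃ (N : ℕ) (M a r₀ : Fin N → ℝ) (mo : Fin N → ↥lorentzGroup × E4),
      (∀ i, Kerr.IsSubextremal (M i) (a i) ∧
        r₀ i ∈ Ioo (Kerr.rMinus (M i) (a i)) (Kerr.rPlus (M i) (a i))) ∧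
      ∀ ε : ℝ, 0 < ε → ∀ τ₁ : ℝ, ∃ τ : ℝ, τ₁ ≤ τ ∧
        ∃ (R : Fin N → ℝ) (U : Opens E4) (Φ : U → 𝒟.carrier),
          SlabClauses 𝒟 k N M a r₀ mo ε τ R U Φ := by
  obtain ⟨N, M, a, r₀, mo, hsub, hrec⟩ := h
  refine ⟨N, M, a, r₀, mo, hsub, fun ε hε τ₁ ↦ ?_⟩
  obtain ⟨τ, hτ, R, U, Φ, hs⟩ := hrec ε hε τ₁
  exact ⟨τ, hτ, R, U, Φ, hs.anti hk⟩

/-- **The good regularities of the crux are upward closed.** If the crux's implication (recurrence at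
`k` and the interior lemma ⇒ the conclusion) holds for every admissible datum and every MGHD with
complete `𝓘⁺`, then so does the implication with recurrence at any `k' ≥ k` (the hypothesis only gets
stronger, `recurrence_anti`). Hence the crux's leading `∃ k` reads "for all sufficiently large `k`": a
proof may fix `k` as large as its estimates require, at no cost to the route. [folklore] -/
theorem killingSpinorEndgame_at_mono {k k' : ℕ} (hk : k ≤ k')
    (h : ∀ (X : Type) [TopologicalSpace X] [ChartedSpace E3 X] [IsManifold (𝓡 3) ∞ X]
      [T2Space X] [SecondCountableTopology X] [ConnectedSpace X] (D : InitialDataSet (𝓡 3) X),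
      D ∈ admissibleVacuumData X → ∀ 𝒟 : VacuumCauchyDevelopment D, 𝒟.IsMaximal →
      Summit.FinalStateConjecture.HasCompleteNullInfinity 𝒟.toCauchyDevelopment →
      (∃ (N : ℕ) (M a r₀ : Fin N → ℝ) (mo : Fin N → ↥lorentzGroup × E4),
        (∀ i, Kerr.IsSubextremal (M i) (a i) ∧
          r₀ i ∈ Ioo (Kerr.rMinus (M i) (a i)) (Kerr.rPlus (M i) (a i))) ∧
        ∀ ε : ℝ, 0 < ε → ∀ τ₁ : ℝ, ∃ τ : ℝ, τ₁ ≤ τ ∧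
          ∃ (R : Fin N → ℝ) (U : Opens E4) (Φ : U → 𝒟.carrier),
            SlabClauses 𝒟 k N M a r₀ mo ε τ R U Φ) →
      (∀ (O : Set 𝒟.carrier) (d : FinalStateDecomposition 𝒟.toSpacetime O 2),
        (∀ i, Kerr.IsSubextremal (d.mass i) (d.spin i)) →
        O = Summit.FinalStateConjecture.exteriorOf 𝒟.toCauchyDevelopment d.charted →
        Summit.FinalStateConjecture.HasExhaustiveCharts d →
        Summit.FinalStateConjecture.IsFutureOriented d →
        Summit.FinalStateConjecture.RaysStayInClosure 𝒟.toCauchyDevelopment O) →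
      ∃ (O : Set 𝒟.carrier) (d : FinalStateDecomposition 𝒟.toSpacetime O 2),
        (∀ i, Kerr.IsSubextremal (d.mass i) (d.spin i)) ∧
        O = Summit.FinalStateConjecture.exteriorOf 𝒟.toCauchyDevelopment d.charted ∧
        Summit.FinalStateConjecture.RaysStayInClosure 𝒟.toCauchyDevelopment O ∧
        Summit.FinalStateConjecture.HasExhaustiveCharts d ∧
        Summit.FinalStateConjecture.IsFutureOriented d) :
    ∀ (X : Type) [TopologicalSpace X] [ChartedSpace E3 X] [IsManifold (𝓡 3) ∞ X]
      [T2Space X] [SecondCountableTopology X] [ConnectedSpace X] (D : InitialDataSet (𝓡 3) X),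
      D ∈ admissibleVacuumData X → ∀ 𝒟 : VacuumCauchyDevelopment D, 𝒟.IsMaximal →
      Summit.FinalStateConjecture.HasCompleteNullInfinity 𝒟.toCauchyDevelopment →
      (∃ (N : ℕ) (M a r₀ : Fin N → ℝ) (mo : Fin N → ↥lorentzGroup × E4),
        (∀ i, Kerr.IsSubextremal (M i) (a i) ∧
          r₀ i ∈ Ioo (Kerr.rMinus (M i) (a i)) (Kerr.rPlus (M i) (a i))) ∧
        ∀ ε : ℝ, 0 < ε → ∀ τ₁ : ℝ, ∃ τ : ℝ, τ₁ ≤ τ ∧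
          ∃ (R : Fin N → ℝ) (U : Opens E4) (Φ : U → 𝒟.carrier),
            SlabClauses 𝒟 k' N M a r₀ mo ε τ R U Φ) →
      (∀ (O : Set 𝒟.carrier) (d : FinalStateDecomposition 𝒟.toSpacetime O 2),
        (∀ i, Kerr.IsSubextremal (d.mass i) (d.spin i)) →
        O = Summit.FinalStateConjecture.exteriorOf 𝒟.toCauchyDevelopment d.charted →
        Summit.FinalStateConjecture.HasExhaustiveCharts d →
        Summit.FinalStateConjecture.IsFutureOriented d →
        Summit.FinalStateConjecture.RaysStayInClosure 𝒟.toCauchyDevelopment O) →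
      ∃ (O : Set 𝒟.carrier) (d : FinalStateDecomposition 𝒟.toSpacetime O 2),
        (∀ i, Kerr.IsSubextremal (d.mass i) (d.spin i)) ∧
        O = Summit.FinalStateConjecture.exteriorOf 𝒟.toCauchyDevelopment d.charted ∧
        Summit.FinalStateConjecture.RaysStayInClosure 𝒟.toCauchyDevelopment O ∧
        Summit.FinalStateConjecture.HasExhaustiveCharts d ∧
        Summit.FinalStateConjecture.IsFutureOriented d := by
  intro X _ _ _ _ _ _ D hD 𝒟 hmax hscri hrec
  exact h X D hD 𝒟 hmax hscri (recurrence_anti 𝒟 hk hrec)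

end Summit.FinalStateConjecture.FinalStateConjecture.Theorems.KerrnessPropagates

end
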